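import Mathlib
import HarnessLib

/-!
# The coordinate-influence bound `|E[F · h(xᵢ)]| ≤ ‖F‖∞ · ‖h‖₁ · P[N]`

Helper file for the crux `QuadrupoleSelectionRule` (stmt-CriticalPhenomena-7029, informal) of route
`CardyFlipRusso` (sub-problem `CardyFormulaZ2`), line `Sketch` (generation 4), stub R2
(`abs_integral_mul_coord_le`).  Along the Gaussian-jitter leg L1 the `σ`-derivative of an
annealed expectation is `σ⁻¹ Σᵢ E[F(σ x) ((xᵢ)² − 1)]` (stub R1,
`hasDerivAt_integral_gaussian_dilate`); the present file bounds ONE summand of such a sum.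

On a finite product `π = ⊗ⱼ μⱼ` of probability measures on `ℝ`, let `F : ℝ^ι → ℝ` be measurable
with `|F| ≤ C`, let `h` be a `μᵢ`-integrable weight of the single coordinate `i` with
`∫ h dμᵢ = 0`, and let `N` be a measurable set of configurations which does not depend on
coordinate `i` and off which `F` does not depend on coordinate `i`.  Then

  `|∫ F(x) h(xᵢ) dπ(x)| ≤ C · (∫ |h| dμᵢ) · π(N)`,

the site-move analogue of the Russo inequality `|Cov(1_U, scoreᵢ)| ≤ 2 P[site i pivotal]`.

Proof.  The one tool is the independence of the coordinate `xᵢ` from the remaining coordinates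
under `π` (`CoordinateInfluence.integral_mul_apply_eq_of_update_eq`): for `φ : ℝ^ι → ℝ` not
depending on coordinate `i` and any `ψ : ℝ → ℝ`, `∫ φ(x) ψ(xᵢ) dπ = (∫ φ dπ) · (∫ ψ dμᵢ)`, obtained
by splitting `ℝ^ι ≃ ℝ^{{i}} × ℝ^{ι ∖ {i}}` (`MeasureTheory.measurePreserving_piEquivPiSubtypeProd`,
`MeasureTheory.measurePreserving_piUnique`) and `MeasureTheory.integral_prod_mul`.  Then
`F h(xᵢ) = 1_N F h(xᵢ) + 1_{Nᶜ} G h(xᵢ)` with `G x = F(x|_{xᵢ = 0})` not depending on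
coordinate `i`; the second term integrates to `(∫ 1_{Nᶜ} G dπ) · (∫ h dμᵢ) = 0`, and the first is
at most `C ∫ 1_N(x) |h(xᵢ)| dπ = C · π(N) · ∫ |h| dμᵢ` by the same factorisation.
-/

noncomputable section

open MeasureTheory Set Function

namespace Summit.CriticalPhenomena.CardyFormulaZ2.Theorems

namespace CoordinateInfluence

variable {ι : Type*} [Fintype ι] [DecidableEq ι]

/-- **One coordinate is independent of the others under a product measure.**  On the finite
product `⊗ⱼ μⱼ` of probability measures on `ℝ`, if `φ : ℝ^ι → ℝ` does not depend on coordinate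
`i` (`φ (update x i t) = φ x`) then for every `ψ : ℝ → ℝ`

  `∫ φ(x) ψ(xᵢ) d(⊗ⱼ μⱼ)(x) = (∫ φ d(⊗ⱼ μⱼ)) · ∫ ψ dμᵢ`.

No measurability or integrability hypothesis is needed (as in `MeasureTheory.integral_prod_mul`,
both sides vanish in the non-integrable cases). [folklore] -/
theorem integral_mul_apply_eq_of_update_eq (μ : ι → Measure ℝ) [∀ j, IsProbabilityMeasure (μ j)]
    (i : ι) (φ : (ι → ℝ) → ℝ) (ψ : ℝ → ℝ) (hφ : ∀ x t, φ (update x i t) = φ x) :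
    ∫ x, φ x * ψ (x i) ∂Measure.pi μ = (∫ x, φ x ∂Measure.pi μ) * ∫ t, ψ t ∂μ i := by
  -- split `ℝ^ι` into the one-point block `{j // j = i}` and the remaining coordinates
  have hmp := (measurePreserving_piEquivPiSubtypeProd μ fun j => j = i).symm
    (MeasurableEquiv.piEquivPiSubtypeProd (fun _ : ι => ℝ) fun j => j = i)
  set e := MeasurableEquiv.piEquivPiSubtypeProd (fun _ : ι => ℝ) (fun j => j = i)
  -- changing the one-point block is an update at `i`
  have key : ∀ z : ({j // j = i} → ℝ) × ({j // ¬j = i} → ℝ),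
      e.symm z = update (e.symm (fun _ => 0, z.2)) i (z.1 ⟨i, rfl⟩) := by
    intro z
    funext j
    by_cases hj : j = i
    · subst hj
      rw [update_self]
      change (if h : j = j then z.1 ⟨j, h⟩ else z.2 ⟨j, h⟩) = z.1 ⟨j, rfl⟩
      rw [dif_pos rfl]
    · rw [update_of_ne hj]
      change (if h : j = i then z.1 ⟨j, h⟩ else z.2 ⟨j, h⟩) =
        if h : j = i then (fun _ : {j // j = i} => (0 : ℝ)) ⟨j, h⟩ else z.2 ⟨j, h⟩
      rw [dif_neg hj, dif_neg hj]
  have hev : ∀ z : ({j // j = i} → ℝ) × ({j // ¬j = i} → ℝ), e.symm z i = z.1 ⟨i, rfl⟩ :=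
    fun z => by rw [key z, update_self]
  have hφz : ∀ z : ({j // j = i} → ℝ) × ({j // ¬j = i} → ℝ),
      φ (e.symm z) = φ (e.symm (fun _ => 0, z.2)) := fun z => by rw [key z, hφ]
  -- the integral over the one-point block is an integral over `ℝ`
  have h3 : ∫ w : {j // j = i} → ℝ, ψ (w ⟨i, rfl⟩)
      ∂(@Measure.pi {j // j = i} (fun _ => ℝ) (Subtype.fintype _) _ fun k => μ k) =
        ∫ t, ψ t ∂μ i := by
    have hinst : (Subtype.fintype fun j => j = i) = Fintype.subtypeEq i := Subsingleton.elim _ _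
    rw [hinst]
    exact (measurePreserving_piUnique fun k : {j // j = i} => μ k).integral_comp' (g := ψ)
  -- transport both integrals over `ℝ^ι` to the product and factorise
  rw [← hmp.integral_comp' (g := fun x => φ x * ψ (x i)), ← hmp.integral_comp' (g := φ)]
  have i1 : (fun z : ({j // j = i} → ℝ) × ({j // ¬j = i} → ℝ) => φ (e.symm z) * ψ (e.symm z i)) =
      fun z => (fun w : {j // j = i} → ℝ => ψ (w ⟨i, rfl⟩)) z.1 *
        (fun y : {j // ¬j = i} → ℝ => φ (e.symm (fun _ => 0, y))) z.2 :=
    funext fun z => by rw [hφz z, hev z, mul_comm]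
  have i2 : (fun z : ({j // j = i} → ℝ) × ({j // ¬j = i} → ℝ) => φ (e.symm z)) =
      fun z => (fun y : {j // ¬j = i} → ℝ => φ (e.symm (fun _ => 0, y))) z.2 :=
    funext fun z => hφz z
  rw [i1, i2, integral_prod_mul (fun w : {j // j = i} → ℝ => ψ (w ⟨i, rfl⟩))
      (fun y : {j // ¬j = i} → ℝ => φ (e.symm (fun _ => 0, y))),
    integral_fun_snd (fun y : {j // ¬j = i} → ℝ => φ (e.symm (fun _ => 0, y))), h3, probReal_univ,
    one_smul, mul_comm]

end CoordinateInfluence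

open CoordinateInfluence in
/-- **Coordinate-influence bound** (stub R2 of line `Sketch`, generation 4, crux
`QuadrupoleSelectionRule`).  Let `π = ⊗ⱼ μⱼ` be a finite product of probability measures on `ℝ`,
`F : ℝ^ι → ℝ` measurable with `|F| ≤ C`, `h : ℝ → ℝ` integrable for `μᵢ` with `∫ h dμᵢ = 0`,
and `N` a measurable set of configurations not depending on coordinate `i`
(`x ∈ N ↔ update x i t ∈ N`) off which `F` does not depend on coordinate `i`.  Then

  `|∫ F(x) · h(xᵢ) dπ(x)| ≤ C · (∫ |h| dμᵢ) · π(N)`.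

(Off `N`, `F(x) h(xᵢ) = G(x) h(xᵢ)` with `G x = F (update x i 0)` independent of `xᵢ`, which
integrates to `(∫ 1_{Nᶜ} G)(∫ h dμᵢ) = 0`; on `N`, `|F h(xᵢ)| ≤ C · 1_N(x) |h(xᵢ)|`, and `1_N` is
independent of `xᵢ`.) [folklore] -/
theorem abs_integral_mul_coord_le : ∀ (ι : Type*) [Fintype ι] [DecidableEq ι]
    (μ : ι → MeasureTheory.Measure ℝ) [∀ i, MeasureTheory.IsProbabilityMeasure (μ i)] (i : ι)
    (F : (ι → ℝ) → ℝ), Measurable F → ∀ C : ℝ, (∀ x, |F x| ≤ C) → ∀ h : ℝ → ℝ,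
    MeasureTheory.Integrable h (μ i) → ∫ t, h t ∂(μ i) = 0 → ∀ N : Set (ι → ℝ),
    MeasurableSet N → (∀ (x : ι → ℝ) (t : ℝ), x ∈ N ↔ Function.update x i t ∈ N) →
    (∀ x ∉ N, ∀ t : ℝ, F (Function.update x i t) = F x) →
    |∫ x, F x * h (x i) ∂(MeasureTheory.Measure.pi μ)| ≤
      C * (∫ t, |h t| ∂(μ i)) * (MeasureTheory.Measure.pi μ).real N := by
  intro ι _ _ μ _ i F hF C hC h hh hh0 N hN hNi hFN
  -- integrability of `h (x i)` and of `F x * h (x i)` under the product measure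
  have hhi : Integrable (fun x : ι → ℝ => h (x i)) (Measure.pi μ) :=
    (measurePreserving_eval μ i).integrable_comp_of_integrable hh
  have hFh : Integrable (fun x : ι → ℝ => F x * h (x i)) (Measure.pi μ) :=
    hhi.bdd_mul hF.aestronglyMeasurable (ae_of_all _ fun x => (Real.norm_eq_abs _).trans_le (hC x))
  -- Step 1: off `N` the integrand is `G x * h (x i)` with `G = F ∘ (update · i 0)` not depending on
  -- coordinate `i`, which integrates to zero; hence `∫ F h(xᵢ) = ∫ 1_N F h(xᵢ)`.
  have hφ₁ : ∀ (x : ι → ℝ) (t : ℝ), Nᶜ.indicator (fun x => F (update x i 0)) (update x i t) =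
      Nᶜ.indicator (fun x => F (update x i 0)) x := by
    intro x t
    by_cases hx : x ∈ N
    · have hx' : update x i t ∈ N := (hNi x t).mp hx
      rw [indicator_of_notMem (notMem_compl_iff.mpr hx'),
        indicator_of_notMem (notMem_compl_iff.mpr hx)]
    · have hx' : update x i t ∉ N := fun h' => hx ((hNi x t).mpr h')
      rw [indicator_of_mem (mem_compl hx'), indicator_of_mem (mem_compl hx), update_idem]
  have hB : (fun x : ι → ℝ => F x * h (x i) - N.indicator (fun x => F x * h (x i)) x) =
      fun x => Nᶜ.indicator (fun x => F (update x i 0)) x * h (x i) := by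
    funext x
    by_cases hx : x ∈ N
    · rw [indicator_of_mem hx, indicator_of_notMem (notMem_compl_iff.mpr hx), sub_self, zero_mul]
    · rw [indicator_of_notMem hx, indicator_of_mem (mem_compl hx), hFN x hx 0, sub_zero]
  have h1 : ∫ x, F x * h (x i) ∂Measure.pi μ =
      ∫ x, N.indicator (fun x => F x * h (x i)) x ∂Measure.pi μ := by
    have h0 := integral_sub hFh (hFh.indicator hN)
    rw [hB, integral_mul_apply_eq_of_update_eq μ i _ h hφ₁, hh0, mul_zero] at h0
    linarith
  -- Step 2: `1_N` does not depend on coordinate `i` either, so `∫ 1_N |h(xᵢ)| = π(N) ∫ |h| dμᵢ`.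
  have hφ₂ : ∀ (x : ι → ℝ) (t : ℝ), N.indicator (fun _ => (1 : ℝ)) (update x i t) =
      N.indicator (fun _ => (1 : ℝ)) x := by
    intro x t
    by_cases hx : x ∈ N
    · rw [indicator_of_mem ((hNi x t).mp hx), indicator_of_mem hx]
    · rw [indicator_of_notMem (fun h' => hx ((hNi x t).mpr h')), indicator_of_notMem hx]
  have h2 : ∫ x, N.indicator (fun _ => (1 : ℝ)) x * |h (x i)| ∂Measure.pi μ =
      (Measure.pi μ).real N * ∫ t, |h t| ∂μ i := by
    rw [integral_mul_apply_eq_of_update_eq μ i _ (fun t => |h t|) hφ₂]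
    -- `N.indicator (fun _ => 1) = N.indicator 1`
    exact congrArg (· * _) (integral_indicator_one hN)
  -- Step 3: the bound
  rw [h1]
  calc |∫ x, N.indicator (fun x => F x * h (x i)) x ∂Measure.pi μ|
      ≤ ∫ x, |N.indicator (fun x => F x * h (x i)) x| ∂Measure.pi μ := abs_integral_le_integral_abs
    _ ≤ ∫ x, C * (N.indicator (fun _ => (1 : ℝ)) x * |h (x i)|) ∂Measure.pi μ := by
        refine integral_mono_of_nonneg (ae_of_all _ fun x => abs_nonneg _)
          (Integrable.const_mul (hhi.abs.bdd_mul (c := 1)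
            ((measurable_const.indicator hN).aestronglyMeasurable)
            (ae_of_all _ fun x => ?_)) C) (ae_of_all _ fun x => ?_)
        · by_cases hx : x ∈ N
          · rw [indicator_of_mem hx, norm_one]
          · rw [indicator_of_notMem hx, norm_zero]; exact zero_le_one
        · show |N.indicator (fun x => F x * h (x i)) x| ≤
            C * (N.indicator (fun _ => (1 : ℝ)) x * |h (x i)|)
          by_cases hx : x ∈ N
          · rw [indicator_of_mem hx, indicator_of_mem hx, one_mul, abs_mul]
            exact mul_le_mul_of_nonneg_right (hC x) (abs_nonneg _)
          · rw [indicator_of_notMem hx, indicator_of_notMem hx, abs_zero, zero_mul, mul_zero]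
    _ = C * (∫ t, |h t| ∂μ i) * (Measure.pi μ).real N := by
        rw [integral_const_mul, h2]; ring

end Summit.CriticalPhenomena.CardyFormulaZ2.Theorems

end
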